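import Literature.Analysis.FluidPDE.TransportHolderEstimate
import Literature.Analysis.FluidPDE.CheskidovGluedCalculus
import Literature.Analysis.FunctionSpaces.TorusInverseLaplacianCalculus
import Literature.Analysis.FunctionSpaces.ContDiffHolderLeibniz
import Literature.Analysis.FluidPDE.OnsagerBDSVSchauderHigher
import HarnessLib

/-!
# Higher-order Hölder estimates for smooth solutions of transport equations on the flat torus

Buckmaster–De Lellis–Székelyhidi–Vicol, *Onsager's conjecture for admissible weak solutions*,
CPAM 72 (2019) = arXiv:1701.08678, App. B, Prop. B.1: besides the `C⁰` and `C^α` transport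
estimates (B.1)–(B.2) (proved in the tree, `TransportHolderEstimate.lean`), the proposition
records the higher-order estimate (B.3),
`[f(t)]_{N+α} ≲ [f₀]_{N+α} + |t|[v]_{N+α}[f₀]₁ + ∫ ([g]_{N+α} + (t-τ)[v]_{N+α}[g]₁) dτ`, obtained by
differentiating the equation `∂ₜf + v·∇f = g` in space: `∂ₖf` solves the transport equation
with the forcing `∂ₖg - (∂ₖv·∇)f`. This file proves the corresponding estimate in the accepted
norms `Torus.eContDiffHolderNorm N α = ‖·‖_{C^{N,α}}` of the tree, in the non-interpolated,
sup-in-time form in which it is consumed by a priori estimates (BDSV §3.1, proof of Prop. 3.1: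
"`∂ₜ∂^θv + v·∇∂^θv + [∂^θ, v·∇]v + ∇∂^θp = 0` … (3.2) follows by applying (B.1) and Grönwall"):
for a smooth solution on `[a, b] × T^d` with `‖Du‖ ≤ K`,

  `‖f(t)‖_{N,α} ≤ (#d + 1)^N e^{αK|t-t₀|} (A + 2|t - t₀| (G + 3^N Σ_{i<N} U_{i+1} Φ_{N-i}))`

whenever `‖f(t₀)‖_{N,α} ≤ A`, and, for `s` between `t₀` and `t`, `‖g(s)‖_{N,α} ≤ G`,
`‖u(s)‖_{j,α} ≤ U_j` (`j ≤ N`) and `‖f(s)‖_{m,α} ≤ Φ_m` (`m ≤ N`)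
(`Torus.eContDiffHolderNorm_transport_le_order`). The sum couples `‖u‖_{j}` with `‖f‖_{N+1-j}`,
`1 ≤ j ≤ N`, exactly as the commutator `[∂^θ, v·∇]` does; interpolation (BDSV (A.3)) then turns
it into `‖u‖_{1+α}‖f‖_{N+α} + ‖u‖_{N+α}‖f‖_{1+α}` where needed.

## Proof

Induction on `N`. The case `N = 0` is the tree's `Torus.eContDiffHolderNorm_transport_le`. For
`N + 1`: `‖f‖_{N+1,α} ≤ ‖f‖_∞ + Σₖ ‖∂ₖf‖_{N,α}` (`BDSV.eContDiffHolderNorm_succ_le_sum`), the sup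
norm is (B.1) (`Torus.eSupNorm_transport_le`), and each `∂ₖf` solves
`∂ₜ∂ₖf + (u·∇)∂ₖf = ∂ₖg - (∂ₖu·∇)f` (`Torus.transport_partialDeriv`: mixed partials commute on
`[a,b] × T^d`, `Torus.timeDerivWithin_partialDeriv_comm`, and
`∂ₖ[(u·∇)f] = (∂ₖu·∇)f + (u·∇)∂ₖf`, `Gluing.partialDeriv_convect`), whose forcing is bounded in
`C^{N,α}` by `G + 3^N Σ U_{j+1} Φ_{N+1-j}` (Leibniz, `Torus.eContDiffHolderNorm_convect_le`), so
that the induction hypothesis applies to `∂ₖf` with the shifted bounds `Φ_{m+1}`.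

## References

* T. Buckmaster, C. De Lellis, L. Székelyhidi Jr., V. Vicol, *Onsager's conjecture for admissible
  weak solutions*, Comm. Pure Appl. Math. 72 (2019) 229–274 = arXiv:1701.08678, App. B,
  Prop. B.1 (B.1)–(B.3); §3.1, proof of Prop. 3.1. [`BuckmasterEtAl2018`]
-/

noncomputable section

open MeasureTheory Set Filter Metric Function
open scoped NNReal ENNReal ContDiff Topology

namespace Literature.Analysis.FluidPDE

namespace Torus

open FunctionSpaces FunctionSpaces.Torus

section Higher

variable {d : Type} [Fintype d] [DecidableEq d] {F : Type} [NormedAddCommGroup F] [NormedSpace ℝ F]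

variable {a b : ℝ} {u : ℝ → UnitAddTorus d → EuclideanSpace ℝ d}

/-- **Differentiating a transport equation in space.** If `∂ₜf + (u·∇)f = g` on `[a,b] × T^d`
(all fields jointly smooth, `a < b`), then for every coordinate `k`,
`∂ₜ(∂ₖf) + (u·∇)(∂ₖf) = ∂ₖg - (∂ₖu·∇)f` (mixed partials commute; Leibniz for the convective
term; BDSV App. B, the derivation of (B.3)). [folklore] -/
theorem transport_partialDeriv (hab : a < b) (hu : IsSmoothSpaceTimeOn (Icc a b) u)
    {f g : ℝ → UnitAddTorus d → F} (hf : IsSmoothSpaceTimeOn (Icc a b) f)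
    (heq : ∀ s ∈ Icc a b, ∀ x, timeDerivWithin (Icc a b) f s x + convect (u s) (f s) x = g s x)
    (k : d) {s : ℝ} (hs : s ∈ Icc a b) (x : UnitAddTorus d) :
    timeDerivWithin (Icc a b) (fun τ => partialDeriv k (f τ)) s x +
        convect (u s) (partialDeriv k (f s)) x =
      partialDeriv k (g s) x - convect (partialDeriv k (u s)) (f s) x := by
  have hS : UniqueDiffOn ℝ (Icc a b) := uniqueDiffOn_Icc hab
  have hfs : IsSmooth (f s) := hf.isSmooth_slice hs
  have hus : IsSmooth (u s) := hu.isSmooth_slice hs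
  have hTs : IsSmooth (timeDerivWithin (Icc a b) f s) := hf.isSmooth_timeDerivWithin hS hs
  have hCs : IsSmooth (convect (u s) (f s)) := hus.convect hfs
  -- `g s = ∂ₜf(s) + (u·∇)f(s)` as functions, so their `∂ₖ` agree
  have hgfun : g s = timeDerivWithin (Icc a b) f s + convect (u s) (f s) := by
    funext y
    exact (heq s hs y).symm
  have h1 : partialDeriv k (g s) x =
      partialDeriv k (timeDerivWithin (Icc a b) f s) x + partialDeriv k (convect (u s) (f s)) x := by
    rw [hgfun, partialDeriv_add (hTs.isContDiff (by simp)) (hCs.isContDiff (by simp)), Pi.add_apply]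
  -- `∂ₖ∂ₜ = ∂ₜ∂ₖ`
  have h2 : partialDeriv k (timeDerivWithin (Icc a b) f s) x =
      timeDerivWithin (Icc a b) (fun τ => partialDeriv k (f τ)) s x :=
    (timeDerivWithin_partialDeriv_comm hab hf hs k x).symm
  -- `∂ₖ[(u·∇)f] = (∂ₖu·∇)f + (u·∇)∂ₖf`
  have h3 : partialDeriv k (convect (u s) (f s)) x =
      convect (partialDeriv k (u s)) (f s) x + convect (u s) (partialDeriv k (f s)) x := by
    rw [Gluing.partialDeriv_convect hus hfs k x, Finset.sum_add_distrib,
      convect_eq_sum_smul_partialDeriv (hfs.isContDiff (by simp)),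
      convect_eq_sum_smul_partialDeriv ((hfs.partialDeriv k).isContDiff (by simp))]
    congr 1
    refine Finset.sum_congr rfl fun j _ => ?_
    rw [partialDeriv_comm hfs k j x]
  rw [h2, h3] at h1
  rw [h1]
  abel

variable {K : ℝ≥0} {t₀ t : ℝ} {α : ℝ≥0} {U : ℕ → ℝ}

/-- **Higher-order Hölder transport estimate** (BDSV Prop. B.1, the `C^{N,α}` form of (B.3), not
interpolated): for a smooth solution of `∂ₜf + (u·∇)f = g` on `[a,b] × T^d` with `‖Du‖ ≤ K`,
`‖f(t₀)‖_{N,α} ≤ A`, and for `s` between `t₀` and `t`: `‖g(s)‖_{N,α} ≤ G`, `‖u(s)‖_{j,α} ≤ U_j`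
(`j ≤ N`), `‖f(s)‖_{m,α} ≤ Φ_m` (`m ≤ N`), all bounds nonnegative,
`‖f(t)‖_{N,α} ≤ (#d + 1)^N e^{αK|t-t₀|} (A + 2|t-t₀| (G + 3^N Σ_{i<N} U_{i+1} Φ_{N-i}))`.
[cite: BuckmasterEtAl2018, Prop. B.1 (B.3)] -/
theorem eContDiffHolderNorm_transport_le_order (hab : a < b) (hu : IsSmoothSpaceTimeOn (Icc a b) u)
    (hK : ∀ s ∈ Icc a b, ∀ x, ‖Torus.fderiv (u s) x‖ ≤ K) (ht₀ : t₀ ∈ Icc a b) (ht : t ∈ Icc a b)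
    (hU0 : ∀ j, 0 ≤ U j) :
    ∀ (N : ℕ) (Φ : ℕ → ℝ) (f g : ℝ → UnitAddTorus d → F) (A G : ℝ), (∀ m, 0 ≤ Φ m) →
      IsSmoothSpaceTimeOn (Icc a b) f → IsSmoothSpaceTimeOn (Icc a b) g →
      (∀ s ∈ Icc a b, ∀ x, timeDerivWithin (Icc a b) f s x + convect (u s) (f s) x = g s x) →
      0 ≤ A → 0 ≤ G → Torus.eContDiffHolderNorm N α (f t₀) ≤ ENNReal.ofReal A →
      (∀ s ∈ uIcc t₀ t, Torus.eContDiffHolderNorm N α (g s) ≤ ENNReal.ofReal G) →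
      (∀ s ∈ uIcc t₀ t, ∀ j, j ≤ N → Torus.eContDiffHolderNorm j α (u s) ≤ ENNReal.ofReal (U j)) →
      (∀ s ∈ uIcc t₀ t, ∀ m, m ≤ N → Torus.eContDiffHolderNorm m α (f s) ≤ ENNReal.ofReal (Φ m)) →
      Torus.eContDiffHolderNorm N α (f t) ≤
        ENNReal.ofReal ((Fintype.card d + 1 : ℝ) ^ N * Real.exp (α * K * |t - t₀|) *
          (A + 2 * |t - t₀| * (G + 3 ^ N * ∑ i ∈ Finset.range N, U (i + 1) * Φ (N - i)))) := by
  intro N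
  induction N with
  | zero =>
    intro Φ f g A G hΦ0 hf hg heq hA hG hfA hgG hUb hΦb
    have h := eContDiffHolderNorm_transport_le hab hu hf heq hK ht₀ ht hA hG hfA hgG
    simpa using h
  | succ N IH =>
    intro Φ f g A G hΦ0 hf hg heq hA hG hfA hgG hUb hΦb
    have hS : UniqueDiffOn ℝ (Icc a b) := uniqueDiffOn_Icc hab
    have hsub : uIcc t₀ t ⊆ Icc a b := uIcc_subset_Icc ht₀ ht
    set T := |t - t₀| with hT
    have hT0 : 0 ≤ T := abs_nonneg _
    set X := Real.exp (α * K * |t - t₀|) with hX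
    have hX1 : 1 ≤ X := Real.one_le_exp (by positivity)
    -- the coupling sum at order `N + 1`
    set S : ℝ := ∑ i ∈ Finset.range (N + 1), U (i + 1) * Φ (N + 1 - i) with hS_def
    have hS0 : 0 ≤ S := Finset.sum_nonneg fun i _ => mul_nonneg (hU0 _) (hΦ0 _)
    -- the bound for each `∂ₖ f`
    set B : ℝ := (Fintype.card d + 1 : ℝ) ^ N * X * (A + 2 * T * (G + 3 ^ (N + 1) * S)) with hB
    have hB0 : 0 ≤ B := by positivity
    have hAB : A + T * G ≤ B := by
      have h1 : (1 : ℝ) ≤ (Fintype.card d + 1 : ℝ) ^ N * X :=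
        one_le_mul_of_one_le_of_one_le (one_le_pow₀ (by norm_cast; omega)) hX1
      have h2 : A + T * G ≤ A + 2 * T * (G + 3 ^ (N + 1) * S) := by
        nlinarith [mul_nonneg hT0 hG, mul_nonneg hT0 (mul_nonneg (pow_nonneg (by norm_num : (0:ℝ) ≤ 3) (N + 1)) hS0)]
      calc A + T * G ≤ 1 * (A + 2 * T * (G + 3 ^ (N + 1) * S)) := by rw [one_mul]; exact h2
        _ ≤ (Fintype.card d + 1 : ℝ) ^ N * X * (A + 2 * T * (G + 3 ^ (N + 1) * S)) :=
            mul_le_mul_of_nonneg_right h1 (by positivity)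
    have hder : ∀ k : d, Torus.eContDiffHolderNorm N α (partialDeriv k (f t)) ≤ ENNReal.ofReal B := by
      intro k
      -- the differentiated equation and its data
      set fk : ℝ → UnitAddTorus d → F := fun τ => partialDeriv k (f τ) with hfk
      set gk : ℝ → UnitAddTorus d → F := fun τ x =>
        partialDeriv k (g τ) x - convect (partialDeriv k (u τ)) (f τ) x with hgk
      have hfk_sm : IsSmoothSpaceTimeOn (Icc a b) fk := hf.partialDeriv hS k
      have hgk_sm : IsSmoothSpaceTimeOn (Icc a b) gk :=
        (hg.partialDeriv hS k).sub ((hu.partialDeriv hS k).convect hf hS)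
      have heqk : ∀ s ∈ Icc a b, ∀ x,
          timeDerivWithin (Icc a b) fk s x + convect (u s) (fk s) x = gk s x := fun s hs x =>
        transport_partialDeriv hab hu hf heq k hs x
      -- initial bound
      have hfkA : Torus.eContDiffHolderNorm N α (fk t₀) ≤ ENNReal.ofReal A :=
        (eContDiffHolderNorm_partialDeriv_le (((hf.isSmooth_slice ht₀)).isContDiff (by
          exact_mod_cast le_top)) k α).trans hfA
      -- forcing bound
      have hgkG : ∀ s ∈ uIcc t₀ t, Torus.eContDiffHolderNorm N α (gk s) ≤
          ENNReal.ofReal (G + 3 ^ N * S) := by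
        intro s hs
        have hs' : s ∈ Icc a b := hsub hs
        have hgs : IsSmooth (g s) := hg.isSmooth_slice hs'
        have hus : IsSmooth (u s) := hu.isSmooth_slice hs'
        have hfs : IsSmooth (f s) := hf.isSmooth_slice hs'
        have h1 : Torus.eContDiffHolderNorm N α (partialDeriv k (g s)) ≤ ENNReal.ofReal G :=
          (eContDiffHolderNorm_partialDeriv_le (hgs.isContDiff (by exact_mod_cast le_top)) k α).trans
            (hgG s hs)
        have h2 : Torus.eContDiffHolderNorm N α (convect (partialDeriv k (u s)) (f s)) ≤
            ENNReal.ofReal (3 ^ N * S) := by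
          refine (eContDiffHolderNorm_convect_le ((hus.partialDeriv k).isContDiff (by exact_mod_cast le_top))
            (hfs.isContDiff (by exact_mod_cast le_top)) α).trans ?_
          have hterm : ∀ j ∈ Finset.range (N + 1),
              Torus.eContDiffHolderNorm j α (partialDeriv k (u s)) *
                  Torus.eContDiffHolderNorm (N - j + 1) α (f s) ≤
                ENNReal.ofReal (U (j + 1) * Φ (N + 1 - j)) := by
            intro j hj
            have hjN : j ≤ N := Nat.lt_succ_iff.1 (Finset.mem_range.1 hj)
            have hu1 : Torus.eContDiffHolderNorm j α (partialDeriv k (u s)) ≤ ENNReal.ofReal (U (j + 1)) :=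
              (eContDiffHolderNorm_partialDeriv_le (hus.isContDiff (by exact_mod_cast le_top)) k α).trans
                (hUb s hs (j + 1) (by omega))
            have hf1 : Torus.eContDiffHolderNorm (N - j + 1) α (f s) ≤ ENNReal.ofReal (Φ (N + 1 - j)) := by
              have he : N - j + 1 = N + 1 - j := by omega
              rw [he]
              exact hΦb s hs (N + 1 - j) (by omega)
            rw [ENNReal.ofReal_mul (hU0 _)]
            exact mul_le_mul' hu1 hf1
          calc (3 : ℝ≥0∞) ^ N * ∑ j ∈ Finset.range (N + 1),
                Torus.eContDiffHolderNorm j α (partialDeriv k (u s)) *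
                  Torus.eContDiffHolderNorm (N - j + 1) α (f s)
              ≤ (3 : ℝ≥0∞) ^ N * ∑ j ∈ Finset.range (N + 1), ENNReal.ofReal (U (j + 1) * Φ (N + 1 - j)) :=
                mul_le_mul' le_rfl (Finset.sum_le_sum hterm)
            _ = ENNReal.ofReal (3 ^ N * S) := by
                rw [hS_def, ENNReal.ofReal_mul (by positivity), ENNReal.ofReal_pow (by norm_num),
                  ENNReal.ofReal_ofNat,
                  ENNReal.ofReal_sum_of_nonneg (fun i _ => mul_nonneg (hU0 _) (hΦ0 _))]
        calc Torus.eContDiffHolderNorm N α (gk s)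
            ≤ Torus.eContDiffHolderNorm N α (partialDeriv k (g s)) +
                Torus.eContDiffHolderNorm N α (convect (partialDeriv k (u s)) (f s)) :=
              FunctionSpaces.Torus.eContDiffHolderNorm_sub_le
                ((hgs.partialDeriv k).isContDiff (by exact_mod_cast le_top))
                (((hus.partialDeriv k).convect hfs).isContDiff (by exact_mod_cast le_top))
          _ ≤ ENNReal.ofReal G + ENNReal.ofReal (3 ^ N * S) := add_le_add h1 h2
          _ = ENNReal.ofReal (G + 3 ^ N * S) := (ENNReal.ofReal_add hG (by positivity)).symm
      -- bounds for `∂ₖ f` at orders `m ≤ N`: the shifted `Φ`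
      have hΦkb : ∀ s ∈ uIcc t₀ t, ∀ m, m ≤ N →
          Torus.eContDiffHolderNorm m α (fk s) ≤ ENNReal.ofReal (Φ (m + 1)) := fun s hs m hm =>
        (eContDiffHolderNorm_partialDeriv_le ((hf.isSmooth_slice (hsub hs)).isContDiff
          (by exact_mod_cast le_top)) k α).trans (hΦb s hs (m + 1) (by omega))
      have hUkb : ∀ s ∈ uIcc t₀ t, ∀ j, j ≤ N →
          Torus.eContDiffHolderNorm j α (u s) ≤ ENNReal.ofReal (U j) := fun s hs j hj =>
        hUb s hs j (hj.trans (Nat.le_succ N))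
      -- induction hypothesis for `∂ₖ f`
      have hIH := IH (fun m => Φ (m + 1)) fk gk A (G + 3 ^ N * S) (fun m => hΦ0 _) hfk_sm hgk_sm heqk
        hA (by positivity) hfkA hgkG hUkb hΦkb
      refine hIH.trans (ENNReal.ofReal_le_ofReal ?_)
      -- compare the two real bounds
      have hsum : ∑ i ∈ Finset.range N, U (i + 1) * Φ (N - i + 1) ≤ S := by
        rw [hS_def, Finset.sum_range_succ]
        have h1 : ∑ i ∈ Finset.range N, U (i + 1) * Φ (N - i + 1) =
            ∑ i ∈ Finset.range N, U (i + 1) * Φ (N + 1 - i) := by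
          refine Finset.sum_congr rfl fun i hi => ?_
          have hi' : i < N := Finset.mem_range.1 hi
          have he : N - i + 1 = N + 1 - i := by omega
          rw [he]
        rw [h1]
        exact le_add_of_nonneg_right (mul_nonneg (hU0 _) (hΦ0 _))
      have h3 : G + 3 ^ N * S + 3 ^ N * ∑ i ∈ Finset.range N, U (i + 1) * Φ (N - i + 1) ≤
          G + 3 ^ (N + 1) * S := by
        have h3N : (0 : ℝ) ≤ 3 ^ N := pow_nonneg (by norm_num) N
        have : 3 ^ N * ∑ i ∈ Finset.range N, U (i + 1) * Φ (N - i + 1) ≤ 3 ^ N * S :=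
          mul_le_mul_of_nonneg_left hsum h3N
        rw [pow_succ]
        nlinarith
      rw [hB]
      have hCX : (0 : ℝ) ≤ (Fintype.card d + 1 : ℝ) ^ N * X := by positivity
      refine mul_le_mul_of_nonneg_left ?_ hCX
      nlinarith [mul_nonneg hT0 (sub_nonneg.2 h3)]
    -- the sup norm
    have hsup : eSupNorm (f t) ≤ ENNReal.ofReal (A + T * G) := by
      have h1 := eSupNorm_transport_le hab hu hf heq hK ht₀ ht
      have hSg : (⨆ s ∈ uIcc t₀ t, eSupNorm (g s)) ≤ ENNReal.ofReal G :=
        iSup₂_le fun s hs => (eSupNorm_le_eContDiffHolderNorm (N + 1) α (g s)).trans (hgG s hs)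
      have hSf : eSupNorm (f t₀) ≤ ENNReal.ofReal A :=
        (eSupNorm_le_eContDiffHolderNorm (N + 1) α (f t₀)).trans hfA
      calc eSupNorm (f t) ≤ eSupNorm (f t₀) + ENNReal.ofReal |t - t₀| * ⨆ s ∈ uIcc t₀ t, eSupNorm (g s) := h1
        _ ≤ ENNReal.ofReal A + ENNReal.ofReal |t - t₀| * ENNReal.ofReal G :=
            add_le_add hSf (mul_le_mul' le_rfl hSg)
        _ = ENNReal.ofReal (A + T * G) := by
            rw [hT, ← ENNReal.ofReal_mul (abs_nonneg _), ← ENNReal.ofReal_add hA (by positivity)]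
    -- assemble
    have hsm : IsSmooth (f t) := hf.isSmooth_slice ht
    calc Torus.eContDiffHolderNorm (N + 1) α (f t)
        ≤ eSupNorm (f t) + ∑ k, Torus.eContDiffHolderNorm N α (partialDeriv k (f t)) :=
          BDSV.eContDiffHolderNorm_succ_le_sum hsm N α
      _ ≤ ENNReal.ofReal (A + T * G) + ∑ _k : d, ENNReal.ofReal B :=
          add_le_add hsup (Finset.sum_le_sum fun k _ => hder k)
      _ = ENNReal.ofReal (A + T * G + Fintype.card d * B) := by
          rw [Finset.sum_const, Finset.card_univ, nsmul_eq_mul, ← ENNReal.ofReal_natCast,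
            ← ENNReal.ofReal_mul (Nat.cast_nonneg _), ← ENNReal.ofReal_add (by positivity) (by positivity)]
      _ ≤ ENNReal.ofReal ((Fintype.card d + 1 : ℝ) ^ (N + 1) * X *
            (A + 2 * T * (G + 3 ^ (N + 1) * S))) := by
          refine ENNReal.ofReal_le_ofReal ?_
          have hcard : (0 : ℝ) ≤ Fintype.card d := Nat.cast_nonneg _
          calc A + T * G + Fintype.card d * B ≤ B + Fintype.card d * B := by linarith
            _ = (Fintype.card d + 1 : ℝ) * B := by ring
            _ = (Fintype.card d + 1 : ℝ) ^ (N + 1) * X * (A + 2 * T * (G + 3 ^ (N + 1) * S)) := by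
                rw [hB]; ring

end Higher

end Torus

end Literature.Analysis.FluidPDE
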